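import Literature.MathematicalPhysics.KineticTheory.HardSphereWindowPressureStatic
import Literature.MathematicalPhysics.KineticTheory.HardSphereDisplacementPathLength
import Literature.MathematicalPhysics.KineticTheory.CollisionTubePullbackPacking
import Summits.AtomisticToContinuum.HydrodynamicLimit.Theorems.AntiMazurCoboundariesInfluenceLocalityTrueCapsExistPrelimA
import Summits.AtomisticToContinuum.HydrodynamicLimit.Theorems.JParityClosureOddContactSymmetryGibbsInvariance

/-!
# Packing of separated points of the flat torus in a minimal-image ball

Route `AntiMazurCoboundaries` of `AtomisticToContinuum/HydrodynamicLimit`, crux stmt-AtomisticToContinuum-14135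
(`CorrectorPressureDecay`), line `almost-invariant-duality`, lead-held layer-2 input h₂ = within-lag SHOT-NOISE
PRESSURE (hypothesis `h₂` of `TransferSkeleton.correctorPressureDecay_of_inputs`); registered sub-goal `snp_packing`.

We prove the elementary packing fact on `𝕋³ = UnitAddTorus (Fin 3)` with the minimal-image distance
`Torus.euclidDist x y = ‖reprSym (x - y)‖`: finitely many points `x i`, `i ∈ I`, pairwise at distance
`≥ ε > 0` and all within distance `ρ` of a point `x₀`, number at most `(2ρ/ε + 1)³`.

Proof: lift to `ℝ³` by `q i := reprSym (x i - x₀)`. Then `‖q i‖ = euclidDist (x i) x₀ ≤ ρ`, and for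
`i ≠ j` the difference `q i - q j` projects onto `(x i - x₀) - (x j - x₀) = x i - x j`, so
`euclidDist (x i) (x j) = ‖reprSym (proj (q i - q j))‖ ≤ ‖q i - q j‖` (`Torus.norm_reprSym_proj_le`:
the minimal image is the shortest image). Hence the `q i` are `ε`-separated in the Euclidean ball of
radius `ρ`, and the Euclidean packing bound `card_le_of_separated` (disjoint balls of radius `ε/2` inside the
ball of radius `ρ + ε/2`, volume count) gives the claim.
-/

noncomputable section

open MeasureTheory Set Filter Topology
open scoped ENNReal Classical

namespace Summit.AtomisticToContinuum.HydrodynamicLimit.Theorems.ShotNoisePressure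

open Literature.Analysis.FluidPDE
open Literature.MathematicalPhysics.KineticTheory (T3 V3 hsDiameter localGibbsLaw gaussMeasure)

/-- The minimal-image distance of two points of the torus is at most the Euclidean distance of their
minimal-image lifts relative to a common base point `x₀`:
`euclidDist x y ≤ ‖reprSym (x - x₀) - reprSym (y - x₀)‖` (the difference of the lifts is an image of
`x - y`, and the minimal image is the shortest one, `Torus.norm_reprSym_proj_le`). [folklore] -/
theorem snp_euclidDist_le_norm_reprSym_sub {d : Type*} [Fintype d] (x y x₀ : UnitAddTorus d) :
    Torus.euclidDist x y ≤ ‖Torus.reprSym (x - x₀) - Torus.reprSym (y - x₀)‖ := by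
  have hproj : Literature.Analysis.FunctionSpaces.Torus.proj (Torus.reprSym (x - x₀) - Torus.reprSym (y - x₀))
      = x - y := by
    rw [sub_eq_add_neg, Literature.Analysis.FunctionSpaces.Torus.proj_add,
      Literature.Analysis.FunctionSpaces.Torus.proj_neg, Torus.proj_reprSym, Torus.proj_reprSym]
    abel
  have h := Torus.norm_reprSym_proj_le (Torus.reprSym (x - x₀) - Torus.reprSym (y - x₀))
  rw [hproj] at h
  rw [Torus.euclidDist_eq]
  exact h

/-- **Packing.** Points of `𝕋³` that are pairwise at minimal-image distance `≥ ε > 0` and all within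
distance `ρ` of a point `x₀` are at most `(2ρ/ε + 1)³` in number (lift by `reprSym (· - x₀)` to disjoint
Euclidean balls of radius `ε/2` inside a ball of radius `ρ + ε/2`; volume count). [folklore] -/
theorem snp_packing : ∀ {n : ℕ} {ε ρ : ℝ} (hε : 0 < ε) (hρ : 0 ≤ ρ) (x₀ : T3) (x : Fin n → T3)
    (I : Finset (Fin n)) (hsep : ∀ i ∈ I, ∀ j ∈ I, i ≠ j → ε ≤ Torus.euclidDist (x i) (x j))
    (hin : ∀ i ∈ I, Torus.euclidDist (x i) x₀ ≤ ρ),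
    (I.card : ℝ) ≤ (2 * ρ / ε + 1) ^ 3 := by
  intro n ε ρ hε hρ x₀ x I hsep hin
  have hR : ∀ j ∈ I, ‖Torus.reprSym (x j - x₀)‖ ≤ ρ := fun j hj => by
    rw [← Torus.euclidDist_eq]
    exact hin j hj
  have hsep' : ∀ j ∈ I, ∀ j' ∈ I, j ≠ j' →
      ε ≤ ‖Torus.reprSym (x j - x₀) - Torus.reprSym (x j' - x₀)‖ := fun j hj j' hj' hne =>
    (hsep j hj j' hj' hne).trans (snp_euclidDist_le_norm_reprSym_sub (x j) (x j') x₀)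
  exact Literature.MathematicalPhysics.KineticTheory.card_le_of_separated I
    (fun j => Torus.reprSym (x j - x₀)) hε hρ hR hsep'

end Summit.AtomisticToContinuum.HydrodynamicLimit.Theorems.ShotNoisePressure

end
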